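import Summits.Ventures.CertifiedArithmetic.LowPrec.DoubleRoundingProductStripFineLaw
import Summits.Ventures.CertifiedArithmetic.LowPrec.DoubleRoundingProductLaw
import Summits.Ventures.CertifiedArithmetic.LowPrec.DoubleRoundingProductEqualPrecision

/-!
# Double rounding of products through ANY embedded register at least as precise: one decision

HONEST FRAMING (venture CertifiedArithmetic / cell `pub-lowprec`): certified error envelopes and
provably optimal rounding/accumulation schemes for low-precision formats under stated cost models;
every table by two implementations; no hardware or vendor claims.

Setting: `x = a·b` exact, `a, b` data of `φ` (`m = m_φ ≥ 1`, `P = m + 1`, quantum `q = 2^L_φ`),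
a register `ψ` holding every value of `φ` (`embedsTest φ ψ`) with `m_ψ ≥ m` and quantum
`q_ψ = q / 2^d`, `d = L_φ - L_ψ ≥ 0`; `DRMul φ ψ` = "`fl_φ ∘ fl_ψ = fl_φ` on all products".
THE DECISION (D-mul-R, `drMul_register_iff`): for every such pair with `φ` DEEP (`bias_φ ≥ m + 3`)
and with headroom `2^(m + bias_φ + 1) ≤ M_φ` (i.e. `maxRat φ ≥ 4`), and `bias_ψ ≥ 1`:
`DRMul φ ψ ↔ mulRegisterTest φ ψ`, the closed-form Boolean
  `(d = 0 ∧ (m_ψ = m ∨ m ≤ 2)) ∨ (d ≥ 1 ∧ m_ψ ≥ 2m + 1 ∧ mulLawTest φ ψ) ∨`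
  `(d ≥ 4 ∧ m = 2 ∧ m_ψ = 4)`,
where `mulLawTest` (`DoubleRoundingProductLaw.lean`) is "`d ≥ 2m + 2`, or `m + 2 ≤ d` and no hit of
the gap table `mulWindowHit (m+1) (2m+2-d)`".  This file proves NOTHING new about rounding: it is
the bookkeeping join of four record-generic decisions already in the tree — equal precision
(`drMul_equal_precision_iff`, THEOREM D-mul-E: `DRMul ↔ d = 0`), equal quanta
(`drMul_sameQ_strip_iff`, D-mul-0⁺: `DRMul ↔ m ≤ 2`), the fat strip `m_ψ ≥ 2m + 1` at `d ≥ 1`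
(`drMul_iff_mulLawTest`), and the fine strip `m + 1 ≤ m_ψ ≤ 2m` at `d ≥ 1`
(`drMul_fine_strip_iff`: `DRMul ↔ (m, m_ψ) = (2, 4) ∧ d ≥ 4`) — under ONE set of side conditions
(`succ_pow_le_headroom`: the headroom clause implies every range clause of the four parts).
§2 states the hypothesis as a Boolean `mulRegisterHyp` and §3 cross-checks the test against the
13 × 13 named matrix `drMulPairs` (`DoubleRoundingProductMatrix.lean`, THEOREM D-dm) by ONE kernel
evaluation: on the 32 named pairs meeting the hypothesis the closed form and the matrix agree
(`mulRegisterTest_named_consistent`) — two routes to the same 32 verdicts inside Lean (the matrix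
was certified cell by cell from witnesses / exhaustion, the test is the law; 31 ✓, one ✗).
This is the × counterpart of the one-line ÷ decision `drDiv_iff_of_embeds`
(`DoubleRoundingDivisionLaw.lean`: same format, or `m_ψ ≥ 2m + 1 ∧ d ≥ m + 1`); for × the answer
needs a finite table in the gap and has the extra innocuous cells `d = 0, P ≤ 3` and `(3,5), d ≥ 4`.
READING.  For a deep source format, × is correctly emulated through a larger register exactly
when: the register has the SAME quantum and either the same precision or `P ≤ 3`; or it has at
least twice the digits (`P_ψ ≥ 2P`) and either `≥ 2P` extra binades of gradual underflow or
`P + 1 ≤ d ≤ 2P - 1` extra binades off the gap table's hits; or `(P, P_ψ) = (3, 5)` with `d ≥ 4`.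
Everything else double-rounds some product incorrectly.  The side conditions serve the negative
families only (tiny or shallow source formats can behave differently: C44 Part 2 lists such rows).
PLACEMENT — KNOWN: `p₂ ≥ 2p₁` suffices with unbounded exponents [Figueroa1995, §3];
[MartinDorelMelquiondMuller2013, Thm 4.1]; for `p₁ < p₂ < 2p₁` and unbounded exponents `p₁ ≤ 3`
is innocuous and `13²` is the only `p₁ = 4` pattern [Rump2016, Lemma 4.5]; `e_min` provisos for
IEEE pairs [Roux2014, Table II].  NEW (modestly, as searched in `pub-lowprec-enum/FRESHNESS-ENUM.md`
gen23–28): the single closed-form decision over format records with both subnormal ranges in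
play.  No hardware or vendor claims; no named cell changes (§3 is a consistency check).
-/

namespace Summit.Ventures.CertifiedArithmetic

open Literature.ComputerArithmetic.FloatingPoint
open Literature.ComputerArithmetic.FloatingPoint.Format
open Literature.ComputerArithmetic.FloatingPoint.MiniFloat

/-! ## §1 The closed-form test and the decision -/

/-- THE REGISTER TEST (D-mul-R): `(d = 0 ∧ (m_ψ = m ∨ m ≤ 2)) ∨ (d ≥ 1 ∧ m_ψ ≥ 2m+1 ∧ mulLawTest)
∨ (d ≥ 4 ∧ m = 2 ∧ m_ψ = 4)`. [this packet] -/
def mulRegisterTest (φ ψ : Format) : Bool :=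
  (decide (ψ.qexp = φ.qexp) && (decide (ψ.manBits = φ.manBits) || decide (φ.manBits ≤ 2))) ||
    (decide (ψ.qexp + 1 ≤ φ.qexp) && decide (2 * φ.manBits + 1 ≤ ψ.manBits) && mulLawTest φ ψ) ||
    (decide (ψ.qexp + 4 ≤ φ.qexp) && decide (φ.manBits = 2) && decide (ψ.manBits = 4))

/-- HEADROOM IMPLIES EVERY RANGE CLAUSE: `2^(m+bias+1) ≤ M ⟹ c·2^e ≤ M` whenever
`c ≤ 2^k` and `k + e ≤ m + bias + 1`. [folklore] -/
theorem succ_pow_le_headroom {m bias M c k e : ℕ} (hR : 2 ^ (m + bias + 1) ≤ M) (hc : c ≤ 2 ^ k)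
    (hke : k + e ≤ m + bias + 1) : c * 2 ^ e ≤ M :=
  calc c * 2 ^ e ≤ 2 ^ k * 2 ^ e := Nat.mul_le_mul_right _ hc
    _ = 2 ^ (k + e) := (pow_add 2 k e).symm
    _ ≤ 2 ^ (m + bias + 1) := Nat.pow_le_pow_right (by norm_num) hke
    _ ≤ M := hR

/-- THE DECISION (D-mul-R) — for EVERY pair of records with `F_φ ⊆ F_ψ` (`embedsTest`, which
includes `m_ψ ≥ m_φ`), `m = m_φ ≥ 1`, `φ` deep (`m + 3 ≤ bias_φ`), headroom
`2^(m + bias_φ + 1) ≤ M_φ`, `bias_ψ ≥ 1`: `DRMul φ ψ ↔ mulRegisterTest φ ψ`. [this packet] -/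
theorem drMul_register_iff {φ ψ : Format} (hE : embedsTest φ ψ = true) (h1 : 1 ≤ φ.manBits)
    (hdeep : φ.manBits + 3 ≤ φ.bias) (hR : 2 ^ (φ.manBits + φ.bias + 1) ≤ φ.maxScaled)
    (hb' : 1 ≤ ψ.bias) : DRMul φ ψ ↔ mulRegisterTest φ ψ = true := by
  have hE' := hE
  simp only [embedsTest, Bool.and_eq_true, decide_eq_true_eq] at hE'
  obtain ⟨⟨hP, hq⟩, -⟩ := hE'
  -- the range clauses of the four parts, all from the headroom clause
  have ha : 2 ^ (φ.manBits + 1) - 1 ≤ φ.maxScaled := by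
    have h := succ_pow_le_headroom (c := 2 ^ (φ.manBits + 1) - 1) (k := φ.manBits + 1) (e := 0)
      hR (Nat.sub_le _ _) (by omega)
    simpa using h
  have hb : (2 ^ φ.manBits + 1) * 2 ^ (φ.bias - φ.manBits - 3) ≤ φ.maxScaled := by
    refine succ_pow_le_headroom (k := φ.manBits + 1) hR ?_ (by omega)
    have : 1 ≤ 2 ^ φ.manBits := Nat.one_le_two_pow
    rw [pow_succ]; omega
  have hroom : (2 ^ (φ.manBits + 1) - 1) * 2 ^ (φ.bias - 4) ≤ φ.maxScaled :=
    succ_pow_le_headroom (k := φ.manBits + 1) hR (Nat.sub_le _ _) (by omega)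
  have hR2 : 2 ^ (2 * φ.manBits + 1) ≤ φ.maxScaled :=
    le_trans (Nat.pow_le_pow_right (by norm_num) (by omega)) hR
  have hone : 2 ^ (φ.bias + φ.manBits - 1) ≤ φ.maxScaled :=
    le_trans (Nat.pow_le_pow_right (by norm_num) (by omega)) hR
  rcases Nat.eq_or_lt_of_le hP with hPe | hPl
  · -- equal precision: `DRMul ↔ d = 0`
    rw [drMul_equal_precision_iff hE hPe.symm h1 hdeep ha hb]
    constructor
    · intro h0; simp [mulRegisterTest, h0, hPe]
    · intro ht
      simp only [mulRegisterTest, Bool.or_eq_true, Bool.and_eq_true, decide_eq_true_eq] at ht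
      omega
  rcases eq_or_lt_of_le hq with hq0 | hq1
  · -- equal quanta, strictly more precise register: `DRMul ↔ m ≤ 2`
    rw [drMul_sameQ_strip_iff hE hq0 h1 (by omega) hR2 hone]
    constructor
    · intro h2; simp [mulRegisterTest, hq0, h2]
    · intro ht
      simp only [mulRegisterTest, Bool.or_eq_true, Bool.and_eq_true, decide_eq_true_eq] at ht
      omega
  by_cases hfat : 2 * φ.manBits + 1 ≤ ψ.manBits
  · -- the fat strip at `d ≥ 1`: `DRMul ↔ mulLawTest`
    rw [drMul_iff_mulLawTest hE h1 hfat (by omega) hdeep hroom]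
    constructor
    · intro hl; simp [mulRegisterTest, hl, hfat, show ψ.qexp + 1 ≤ φ.qexp by omega]
    · intro ht
      simp only [mulRegisterTest, Bool.or_eq_true, Bool.and_eq_true, decide_eq_true_eq] at ht
      rcases ht with (⟨h0, -⟩ | ⟨-, hl⟩) | ⟨⟨-, hm⟩, hmψ⟩
      · omega
      · exact hl
      · omega
  · -- the fine strip at `d ≥ 1`: `DRMul ↔ (m, m_ψ) = (2, 4) ∧ d ≥ 4`
    rw [drMul_fine_strip_iff hE h1 (by omega) (by omega) (by omega) hdeep hR hb']
    constructor
    · rintro ⟨hm, hmψ, h4⟩; simp [mulRegisterTest, hm, hmψ, h4]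
    · intro ht
      simp only [mulRegisterTest, Bool.or_eq_true, Bool.and_eq_true, decide_eq_true_eq] at ht
      rcases ht with (⟨h0, -⟩ | ⟨⟨-, hf⟩, -⟩) | ⟨⟨h4, hm⟩, hmψ⟩
      · omega
      · omega
      · exact ⟨hm, hmψ, h4⟩

/-! ## §2 The hypothesis as a Boolean -/

/-- THE HYPOTHESIS OF D-mul-R AS A TEST on records: embedding (incl. `m_ψ ≥ m_φ`), `m_φ ≥ 1`,
depth `m_φ + 3 ≤ bias_φ`, headroom `2^(m_φ + bias_φ + 1) ≤ M_φ`, `bias_ψ ≥ 1`. [this packet] -/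
def mulRegisterHyp (φ ψ : Format) : Bool :=
  embedsTest φ ψ && decide (1 ≤ φ.manBits) && decide (φ.manBits + 3 ≤ φ.bias) &&
    decide (2 ^ (φ.manBits + φ.bias + 1) ≤ φ.maxScaled) && decide (1 ≤ ψ.bias)

/-- D-mul-R UNDER THE BOOLEAN HYPOTHESIS. [this packet] -/
theorem drMul_iff_of_mulRegisterHyp {φ ψ : Format} (h : mulRegisterHyp φ ψ = true) :
    DRMul φ ψ ↔ mulRegisterTest φ ψ = true := by
  simp only [mulRegisterHyp, Bool.and_eq_true, decide_eq_true_eq] at h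
  obtain ⟨⟨⟨⟨hE, h1⟩, hdeep⟩, hR⟩, hb'⟩ := h
  exact drMul_register_iff hE h1 hdeep hR hb'

/-! ## §3 Consistency with the named matrix (THEOREM D-dm) -/

/-- THE NAMED PAIRS MEETING THE HYPOTHESIS: `32` of the `169` ordered pairs of `namedFormats`
(deep sources e4m3, e5m2, binary8p3, binary8p4, binary8p3f, binary8p4f, binary16, bfloat16,
binary32 against their embedded registers; e2m1, e3m2, e2m3, binary8p5 are not deep).
[this packet] -/
theorem mulRegisterHyp_named_count :
    ((namedFormats ×ˢ namedFormats).filter fun p => mulRegisterHyp p.1 p.2).length = 32 := by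
  decide +kernel

/-- CONSISTENCY — on every named pair meeting the hypothesis the closed-form test agrees with the
certified matrix `drMulPairs`: ONE kernel evaluation, independent of `drMul_register_iff` (which
implies it through `drMul_named_iff`). [this packet] -/
theorem mulRegisterTest_named_consistent : ∀ X ∈ namedFormats, ∀ Y ∈ namedFormats,
    mulRegisterHyp X Y = true → (mulRegisterTest X Y = true ↔ (X, Y) ∈ drMulPairs) := by
  decide +kernel

/-- THE SAME CONSISTENCY FROM THE THEOREMS (the structural route). [this packet] -/
theorem mulRegisterTest_named_consistent' {X Y : Format} (hX : X ∈ namedFormats)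
    (hY : Y ∈ namedFormats) (h : mulRegisterHyp X Y = true) :
    mulRegisterTest X Y = true ↔ (X, Y) ∈ drMulPairs := by
  rw [← drMul_iff_of_mulRegisterHyp h, drMul_named_iff hX hY]

/-- THE 32 VERDICTS: `31` ✓ (the 9 identities, the equal-quantum pairs binary8p3 → binary8p3f and
binary8p4 → binary8p4f, and 20 registers with at least twice the digits and `d ≥ 2P` — clause (U)
of `mulLawTest`; no named pair meets the gap or the `(3, 5)` clause) and exactly ONE ✗:
e5m2 → binary8p3f (equal precision, `d = 1`: THEOREM N-mul-E). [this packet] -/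
theorem mulRegister_named_failing :
    ((namedFormats ×ˢ namedFormats).filter fun p =>
        mulRegisterHyp p.1 p.2 && !mulRegisterTest p.1 p.2) = [(E5M2, Binary8p3F)] := by
  decide +kernel

end Summit.Ventures.CertifiedArithmetic
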